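import Summits.BirchSwinnertonDyer.BirchSwinnertonDyer.Theses.AlignedTransportAtTwo
import Summits.BirchSwinnertonDyer.BirchSwinnertonDyer.Theorems.AlignedTransportAtTwoBSDOfMainConjectureRankOneAtTwoEulerCharAtTwoAssemblyDivisible
import Summits.BirchSwinnertonDyer.BirchSwinnertonDyer.Theorems.AlignedTransportAtTwoBSDOfMainConjectureRankOneAtTwoDisegniTight
import Summits.BirchSwinnertonDyer.BirchSwinnertonDyer.Theorems.AlignedTransportAtTwoBSDOfMainConjectureRankOneAtTwoEulerCharAtTwoCellIndex
import HarnessLib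

/-! # Line `birth` — v7 PROPOSAL (attach seat `bsd-line-att-p4` g7 for the C3′ lead lineage `bsd-line-att-p1`; NOT registered — the lead's call)
crux `Summit.BirchSwinnertonDyer.BirchSwinnertonDyer.Theses.AlignedTransportAtTwo.BSDOfMainConjectureRankOneAtTwo` (stmt-BirchSwinnertonDyer-23008).

**v7 = v5/v6 with the ONE open stub RE-POINTED at the `Ш`-FREE KERNEL-INDEX statement at `2` on the cell, at the price of ONE more PRINT stub
(Greenberg Prop. 4.14 / Hachimori–Matsuno Cor. (i), `Greenberg1999.prop414_noFiniteSubmodule_of_not_dvd_torsionOrder`, already a stub currency of the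
cell: att-p4 g6 p628023).** By the kernel theorems of att-p4 g7 (`…EulerCharAtTwoAssembly` p634759, `…Kummer` p635075, `…Divisible` p636658,
`…Canonical` p636994) the per-curve open stub `SchneiderLeadingTermFormulaAtTwoSqAt W` is, for a cell curve `W` (good ordinary at `2`, no rational
`2`-torsion) and modulo Prop. 4.14 at `2`, EQUIVALENT to `stub_kerIndexAtTwo` below read at `W`
(`…Divisible.schneiderLeadingTermFormulaAtTwoSqAt_iff_kerIndexAt_of_prop414`): for every cyclotomic datum, every finitely generated torsion
strict-at-`∞` dual `D`, THE `Σ²` height `Dh` with `Reg₂(Dh) ≠ 0`, `Ш(E/ℚ)(2)` finite, and every identification `e`, `e₀`, injection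
`κ : M ↪ Sel_{2^∞}(E/ℚ)` of cokernel order `#Ш(2)` — the derived Kummer map `θ = φ_{Sel} ∘ e ∘ s₀ ∘ e₀ ∘ κ : M → H¹(Γ, Sel_{2^∞}(E/ℚ_∞))` has finite
kernel, trivial cokernel, and `#ker θ · #(A₀/Sel₀) · (log₂5)^{rank E(ℚ)} = u · Reg₂(Dh) · 2^{v₂(∏c_v)} · #Ẽ(𝔽₂)(2)²`. `Ш` does not occur in it.
WHY RE-POINT: the obligation now names exactly the two printed-at-odd-`p` computations missing at `2` — Greenberg's index `#(A₀/Sel₀)` against the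
local Euler factors (LNM 1716 Lemmas 4.4/4.7) and the derived-height kernel `#ker θ` against `Reg₂/(log₂5)^r` («algebraic height = Bockstein»,
Perrin-Riou 1992 §3.4 / Schneider 1985) — with control, duality, Λ-algebra, the Kummer sequence, `Ш`-cancellation and the triviality of `coker θ` all
kernel-discharged. Stub set: M, GZK, Σ², Disegni, Prop414 (PRINT ×5) + ONE open statement (6 ≤ stubs_max 7). Composition concludes the crux BY NAME
(per curve: `…Divisible.…_iff_kerIndexAt_of_prop414` then `…DisegniTight.leadingTermFormulaAtTwoAt_iff_bsdp`, p611969). v5's stub is RECOVERED on the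
cell (`stub_leadingTermFormulaAtTwoAt_of_v7`). HONEST FRAMING: BSD is not proved; C3′ stays OPEN modulo exactly ONE statement not in print at `2` and
five published facts; every `stub_*` is `sorry`. -/

set_option linter.dupNamespace false

noncomputable section

namespace Summit.BirchSwinnertonDyer.BirchSwinnertonDyer.Cruxes.BSDOfMainConjectureRankOneAtTwo.Birth

open Summit.BirchSwinnertonDyer.BirchSwinnertonDyer.Theses.AlignedTransportAtTwo
open WeierstrassCurve Literature.NumberTheory.EllipticCurves Literature.NumberTheory.EllipticCurves.ModularForms CongruenceSubgroup
  Literature.NumberTheory.EllipticCurves.Greenberg1999 Literature.NumberTheory.EllipticCurves.IwasawaAlgebra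
  Literature.NumberTheory.EllipticCurves.IwasawaDual
  Summit.BirchSwinnertonDyer.Rank1Residual.F1Sign2 Summit.BirchSwinnertonDyer.BirchSwinnertonDyer.Theorems.Rank1ResidualX1Defs

/-- stub M — PRINT: modularity in the parametrisation currency (`nonempty_modularParametrizationData`, BCDT 2001 Thm A + Edixhoven). -/
theorem stub_modularityAtTwo : nonempty_modularParametrizationData := by
  sorry

/-- stub L0a — PRINT: Gross–Zagier–Kolyvagin (`rank_eq_analyticRank_of_analyticRank_le_one`). [cite: GrossZagier1986] [cite: Kolyvagin1990] -/
theorem stub_gzkAtTwo : rank_eq_analyticRank_of_analyticRank_le_one := by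
  sorry

/-- stub L0b — PRINT: the Mazur–Tate sigma-squared division series at `2` (`mazurTate_sigmaSq_existsUnique_two`). [cite: MazurTate1991, Thm. 3.1] -/
theorem stub_sigmaSqTwo : mazurTate_sigmaSq_existsUnique_two := by
  sorry

/-- stub D — PRINT: Disegni 2020 Thm. 1 (`Disegni2020.padicBSD_goodOrd_rankOne`). [cite: Disegni2020, Thm. 1] -/
theorem stub_disegniAtTwo : Disegni2020.padicBSD_goodOrd_rankOne := by
  sorry

/-- stub P414 — PRINT: Greenberg Prop. 4.14 / Hachimori–Matsuno Cor. (i) at every `p` (`prop414_noFiniteSubmodule_of_not_dvd_torsionOrder`):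
`p ∤ #E(ℚ)_tors ⇒ X(E/ℚ_∞)` has no non-zero finite `Λ`-submodule. [cite: GreenbergLNM1716, Prop. 4.14] [cite: HachimoriMatsuno2000, Cor. (i)] -/
theorem stub_prop414AtTwo : prop414_noFiniteSubmodule_of_not_dvd_torsionOrder := by
  sorry

/-- stub KI — THE ONE OPEN statement at `2` (v7): the `Ш`-FREE KERNEL-INDEX FORMULA on the cell — for `W/ℚ` globally minimal, good ordinary at `2`,
`E(ℚ)[2] = 0` and `2 ∤ #E(ℚ)_tors` (the cell binder «no rational `2`-torsion»), every cyclotomic datum `(κ, γ)`, every finitely generated `Λ`-torsion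
strict-at-`∞` dual `D`, THE canonical `Σ²` height `Dh` with `Reg₂(Dh) ≠ 0`, `Ш(E/ℚ)(2)` finite, every identification `e`, `e₀` and every injection
`κ : M ↪ Sel_{2^∞}(E/ℚ)` with cokernel of order `#Ш(2)` (canonically the Kummer map): the derived Kummer map `θ` has finite kernel, trivial cokernel,
and `#ker θ · #(A₀/Sel₀) · (log₂5)^{rank E(ℚ)} = u · Reg₂(Dh) · 2^{v₂(∏c_v)} · #Ẽ(𝔽₂)(2)²`, `u ∈ ℤ₂ˣ`. NOT in print at `2` over `ℚ` (its two halves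
are Greenberg LNM 1716 Lemmas 4.4/4.7 and Perrin-Riou 1992 §3.4 / Schneider 1985, printed for odd `p`).
[cite: GreenbergLNM1716, §4 Lemmas 4.4–4.7 (printed; the p = 2 positive-rank text is ours)] [cite: PerrinRiou1992, §3.4 (p odd)] -/
theorem stub_kerIndexAtTwo :
    ∀ (W : WeierstrassCurve ℚ) [W.IsElliptic] [W.IsGloballyMinimal],
      IsOrdinaryAt W 2 → (∀ P : W.toAffine.Point, 2 • P = 0 → P = 0) → ¬ 2 ∣ W.torsionOrder →
      ∀ (κ : ZpExtension ℚ 2) (γ : Field.absoluteGaloisGroup ℚ),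
        κ.IsCyclotomic → κ.IsTopGenerator γ → IsCyclotomicVariable 2 γ →
      ∀ (D : W.SelmerDualData κ γ) [Module.Finite (IwasawaAlgebra 2) D.X], D.IsTorsion →
      ∀ (Dh : PAdicHeightData W 2), Dh.IsCanonicalSq →
        SchneiderConjecture Dh → Finite (AddCommGroup.primaryComponent W.sha 2) →
      ∀ (e : ↥(W.selmerInfty κ ⊓ W.layerInvariants κ 0) ≃+ ↥(endInvariants (W.conjSelmerInfty κ γ - 1)))
        (e₀ : ↥(W.selmerGroupPInfty 2) ≃+ ↥(W.selmerLayer κ 0))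
        (M : Type) [AddCommGroup M] (kS : M →+ ↥(W.selmerGroupPInfty 2)), Function.Injective kS →
        Nat.card (↥(W.selmerGroupPInfty 2) ⧸ kS.range) = Nat.card (AddCommGroup.primaryComponent W.sha 2) →
      ∀ (θ : M →+ EndCoinvariants (W.conjSelmerInfty κ γ - 1)),
        θ = (W.selmerInftyEulerMap κ γ).comp
          (((e : ↥(W.selmerInfty κ ⊓ W.layerInvariants κ 0) →+ ↥(endInvariants (W.conjSelmerInfty κ γ - 1))).comp (W.sMap κ 0)).comp
            ((e₀ : ↥(W.selmerGroupPInfty 2) →+ ↥(W.selmerLayer κ 0)).comp kS)) →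
        Finite θ.ker ∧ Nat.card (EndCoinvariants (W.conjSelmerInfty κ γ - 1) ⧸ θ.range) = 1 ∧
        ∃ u : ℤ_[2]ˣ,
          (Nat.card θ.ker : ℚ_[2]) * Nat.card (W.KerG κ 0) * padicLog 2 (cyclotomicGenerator 2) ^ W.mordellWeilRank =
            ((u : ℤ_[2]) : ℚ_[2]) * padicRegulator Dh * (2 : ℚ_[2]) ^ (padicValNat 2 W.tamagawaProduct) *
              (Nat.card (AddCommGroup.primaryComponent
                ((integralModelInt W).map (Int.castRingHom (ZMod 2))).toAffine.Point 2) : ℚ_[2]) ^ 2 := by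
  sorry

/-- Cell glue (proved): «no rational `2`-torsion abscissa» ⇒ `E(ℚ)[2] = 0` (tree `X5.O1.irr_two_iff_forall_two_nsmul` after the `Irr` computation
of `…EulerCharAtTwoCellIndex.not_two_dvd_torsionOrder_…`, inlined). -/
theorem forall_two_nsmul_of_forall_not_hasRationalTwoTorsionX (W : WeierstrassCurve ℚ) [W.IsElliptic]
    (ht : ∀ x : ℚ, ¬ HasRationalTwoTorsionX W x) : ∀ P : W.toAffine.Point, 2 • P = 0 → P = 0 := by
  refine (Summit.BirchSwinnertonDyer.Rank1Residual.X5.O1.irr_two_iff_forall_two_nsmul W).mp ?_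
  rw [Summit.BirchSwinnertonDyer.Rank1Residual.X5.O1.irr_two_iff_not_exists_addOrderOf_eq_two]
  rintro ⟨P, hP⟩
  have h2 : (2 : ℕ) • P = 0 := by rw [← hP]; exact addOrderOf_nsmul_eq_zero P
  have hP0 : P ≠ 0 := by
    rintro rfl
    rw [addOrderOf_zero] at hP
    exact absurd hP (by norm_num)
  rcases P with _ | ⟨x, y, hns⟩
  · exact absurd rfl hP0
  · refine ht x ⟨y, hns.1, ?_⟩
    have hneg : (WeierstrassCurve.Affine.Point.some x y hns : W.toAffine.Point) =
        -WeierstrassCurve.Affine.Point.some x y hns :=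
      eq_neg_of_add_eq_zero_left (by rwa [two_nsmul] at h2)
    rw [WeierstrassCurve.Affine.Point.neg_some, WeierstrassCurve.Affine.Point.some.injEq] at hneg
    have hy : y = -y - W.a₁ * x - W.a₃ := hneg.2
    linear_combination hy

/-- v5's stub RECOVERED ON THE CELL from v7's (nothing registered under v5 is lost there): for a cell curve, the Schneider leading-term formula
at `2` at `W` (`SchneiderLeadingTermFormulaAtTwoSqAt W`), from KI + P414 via `…Divisible.schneiderLeadingTermFormulaAtTwoSqAt_iff_kerIndexAt_of_prop414`. -/
theorem stub_leadingTermFormulaAtTwoAt_of_v7 (W : WeierstrassCurve ℚ) [W.IsElliptic] [W.IsGloballyMinimal] (hord : IsOrdinaryAt W 2)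
    (ht : ∀ x : ℚ, ¬ HasRationalTwoTorsionX W x) : SchneiderLeadingTermFormulaAtTwoSqAt W :=
  have hK := forall_two_nsmul_of_forall_not_hasRationalTwoTorsionX W ht
  have h2 := Summit.BirchSwinnertonDyer.BirchSwinnertonDyer.Theorems.AlignedTransportAtTwoEulerCharAtTwoCellIndex.not_two_dvd_torsionOrder_of_forall_not_hasRationalTwoTorsionX
    W ht
  (Summit.BirchSwinnertonDyer.BirchSwinnertonDyer.Theorems.AlignedTransportAtTwoEulerCharAtTwoAssemblyDivisible.schneiderLeadingTermFormulaAtTwoSqAt_iff_kerIndexAt_of_prop414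
      W stub_prop414AtTwo hK h2 hord).mpr
    (stub_kerIndexAtTwo W hord hK h2)

/-- Composition (kernel-checked, closed): the crux BY NAME from the six stubs — per cell curve, KI + P414 give the leading-term formula at `W`
(`stub_leadingTermFormulaAtTwoAt_of_v7`), and `…DisegniTight.leadingTermFormulaAtTwoAt_iff_bsdp` (p611969; Disegni, GZK, modularity, `Σ²`) gives
`BSDp W 2`. -/
theorem BSDOfMainConjectureRankOneAtTwo_of : BSDOfMainConjectureRankOneAtTwo := by
  intro W _ _ _hcm hord ht _hsq hr hL hMC
  exact (Summit.BirchSwinnertonDyer.BirchSwinnertonDyer.Theorems.AlignedTransportAtTwoDisegniTight.leadingTermFormulaAtTwoAt_iff_bsdp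
    stub_disegniAtTwo stub_gzkAtTwo stub_modularityAtTwo stub_sigmaSqTwo W hord hr hL hMC).mp
    (stub_leadingTermFormulaAtTwoAt_of_v7 W hord ht hord.1 hord.2)

end Summit.BirchSwinnertonDyer.BirchSwinnertonDyer.Cruxes.BSDOfMainConjectureRankOneAtTwo.Birth

end
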